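import Summits.CriticalPhenomena.CardyFormulaZ2.Theorems.CardyBoundaryCoulombGasHalfPlaneMarkDensityLawTwoArmPoint
import Summits.CriticalPhenomena.CardyFormulaZ2.Theorems.CardyBoundaryCoulombGasHalfPlaneMarkDensityLawSymmDiffInclusion
import Literature.Probability.Percolation.RSWProofs

/-!
# `HalfPlaneMarkDensityLaw` (crux stmt-CriticalPhenomena-5661), line `Sketch`:
# stub `stub_lisoOfGlobal` — Werner's counting argument, deterministic half (mirrored, primal form)

For critical bond percolation on `ℤ²`, the LOWER bound `c/R ≤ P(liso 0 R)` for the left-isolated arm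
event at a boundary vertex of the lattice half-plane (W. Werner, *Lectures on two-dimensional
critical percolation*, PCMI 2007, Lecture 2, first exercise sheet, "Two-arm exponent in the
half-plane", part 1) rests on a deterministic inclusion, proved here configuration-wise for lattice
configurations `ω ⊆ E(ℤ²)` and `q ≥ 1`.  Suppose

* (shield) there is NO open left–right crossing of the box `[0,q] × [0,4q]`;
* (pillar) there is an open top–bottom crossing of the box `[2q,4q] × [0,4q]`;
* (beam) there is an open left–right crossing of the box `[2q,8q+1] × [0,4q]`.

Then some `u ∈ [0,4q]` carries the left-isolated arm event `liso u (4q)`: `(u,0)` is joined inside the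
half-box `Λ⁺_{4q}(u) = [u−4q, u+4q] × [0,4q]` to its rim, and no vertex of `[u−4q, u−1] × {0}` is
joined to `(u,0)` inside `Λ⁺_{4q}(u)`.

Proof.  Work in the strip `T = ℤ × [0,4q]`.
* The pillar and the part of the beam before its first visit to the column `4q` are a top–bottom and
  a left–right crossing of `[2q,4q] × [0,4q]`, so they meet (`exists_mem_support_of_crossing`, the
  discrete Jordan lemma); hence the foot `(b₀,0)`, `b₀ ∈ [2q,4q]`, of the pillar is joined inside `T`
  to the column `8q+1` (`exists_reach`).
* Let `u` be the LEAST `u ∈ [0,4q]` such that `(u,0)` is joined inside `T` to the column `8q+1`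
  (`Int.exists_least_of_bdd`).
* Arm: the column `8q+1` lies outside `Λ⁺_{4q}(u)`, so the first-exit lemma `SymmDiff.arm_of_far`
  gives the arm clause.
* Isolation: if `(v₀,0)`, `v₀ ∈ [u−4q, u−1]`, were joined to `(u,0)` inside `Λ⁺_{4q}(u) ⊆ T`, it
  would be joined inside `T` to the column `8q+1`; for `v₀ ≥ 0` this contradicts minimality, and for
  `v₀ < 0` the open path passes the columns `0` and `q` inside `T`, producing an open left–right
  crossing of the shield box `[0,q] × [0,4q]` (`exists_openConnIn_column`,
  `exists_openConnIn_column_ge`), a contradiction (`lrCrossing_of_conn`).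
-/

noncomputable section

namespace Summit.CriticalPhenomena.CardyFormulaZ2.Cruxes.HalfPlaneMarkDensityLaw.SketchLine

open Literature.Probability.Percolation Literature.Probability.LatticeModels
open MeasureTheory Filter Set SimpleGraph
open scoped Topology
open Summit.CriticalPhenomena.CardyFormulaZ2.Theorems.HalfPlaneMarkDensityLaw.Negative

namespace TwoArmLower

namespace LisoOfGlobal

/-- **Shield contradiction.** An open path inside the strip `ℤ × [0,4q]` from a vertex `v` with
`v₀ ≤ 0` to a vertex `w` with `q ≤ w₀` contains an open left–right crossing of `[0,q] × [0,4q]`: the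
segment between its last visit to the column `0` before its first visit to the column `q`.
[folklore] -/
theorem lrCrossing_of_conn {q : ℕ} {ω : BondConfig (Site 2)} (hω : ω ⊆ (zdGraph 2).edgeSet)
    {v w : Site 2} (hv : v 0 ≤ 0) (hw : (q : ℤ) ≤ w 0)
    (h : ω ∈ openConnIn {z : Site 2 | 0 ≤ z 1 ∧ z 1 ≤ 4 * (q : ℤ)} v w) :
    ω ∈ lrCrossing q (4 * q) := by
  -- first visit to the column `q`
  obtain ⟨z, hz0, hvz⟩ := exists_openConnIn_column hω (q : ℤ) (by omega) hw h
  -- last visit to the column `0` before that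
  obtain ⟨z', hz'0, hzz'⟩ :=
    exists_openConnIn_column_ge hω (0 : ℤ) (by omega) hv (SymmDiff.conn_symm hvz)
  have hsub : ({z : Site 2 | 0 ≤ z 1 ∧ z 1 ≤ 4 * (q : ℤ)} ∩ {z : Site 2 | z 0 ≤ (q : ℤ)} ∩
      {z : Site 2 | (0 : ℤ) ≤ z 0}) ⊆ (↑(rectangle q (4 * q)) : Set (Site 2)) := by
    intro a ha
    simp only [mem_inter_iff, mem_setOf_eq] at ha
    rw [Finset.mem_coe, mem_rectangle_iff]
    push_cast
    omega
  obtain ⟨hzS, hz'S, hzz'r⟩ := hzz'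
  refine ⟨z', ?_, z, ?_, openConnIn_mono hsub _ _ (SymmDiff.conn_symm ⟨hzS, hz'S, hzz'r⟩)⟩
  · have hz'R := hsub hz'S
    rw [Finset.mem_coe] at hz'R ⊢
    exact Finset.mem_filter.2 ⟨hz'R, hz'0⟩
  · have hzR := hsub hzS
    rw [Finset.mem_coe] at hzR ⊢
    exact Finset.mem_filter.2 ⟨hzR, hz0⟩

/-- **The pillar's foot reaches the far column.** From the pillar (open top–bottom crossing of
`[2q,4q] × [0,4q]`) and the beam (open left–right crossing of `[2q,8q+1] × [0,4q]`), some boundary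
vertex `(b₀,0)` with `b₀ ∈ [0,4q]` is joined inside the strip `ℤ × [0,4q]` to a vertex of the column
`8q+1`: the pillar meets the part of the beam before its first visit to the column `4q`. [folklore] -/
theorem exists_reach {q : ℕ} {ω : BondConfig (Site 2)} (hω : ω ⊆ (zdGraph 2).edgeSet)
    (hV : ω ∈ openCrossing
      ((· + (![2 * (q : ℤ), 0] : Site 2)) '' (↑(rectangle (2 * q) (4 * q)) : Set (Site 2)))
      ((· + (![2 * (q : ℤ), 0] : Site 2)) '' (↑(bottomSide (2 * q) (4 * q)) : Set (Site 2)))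
      ((· + (![2 * (q : ℤ), 0] : Site 2)) '' (↑(topSide (2 * q) (4 * q)) : Set (Site 2))))
    (hH : ω ∈ openCrossing
      ((· + (![2 * (q : ℤ), 0] : Site 2)) '' (↑(rectangle (6 * q + 1) (4 * q)) : Set (Site 2)))
      ((· + (![2 * (q : ℤ), 0] : Site 2)) '' (↑(leftSide (6 * q + 1) (4 * q)) : Set (Site 2)))
      ((· + (![2 * (q : ℤ), 0] : Site 2)) '' (↑(rightSide (6 * q + 1) (4 * q)) : Set (Site 2)))) :
    ∃ b₀ : ℤ, 0 ≤ b₀ ∧ b₀ ≤ 4 * (q : ℤ) ∧ ∃ y : Site 2, y 0 = 8 * (q : ℤ) + 1 ∧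
      ω ∈ openConnIn {z : Site 2 | 0 ≤ z 1 ∧ z 1 ≤ 4 * (q : ℤ)} (bpt b₀) y := by
  classical
  set T : Set (Site 2) := {z : Site 2 | 0 ≤ z 1 ∧ z 1 ≤ 4 * (q : ℤ)} with hT
  have hVT : (· + (![2 * (q : ℤ), 0] : Site 2)) '' (↑(rectangle (2 * q) (4 * q)) : Set (Site 2))
      ⊆ T := by
    intro z hz
    rw [mem_image_add_rectangle] at hz
    simp only [Matrix.cons_val_zero, Matrix.cons_val_one, zero_add] at hz
    push_cast at hz
    exact ⟨hz.2.2.1, hz.2.2.2⟩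
  have hHT : (· + (![2 * (q : ℤ), 0] : Site 2)) '' (↑(rectangle (6 * q + 1) (4 * q)) : Set (Site 2))
      ⊆ T := by
    intro z hz
    rw [mem_image_add_rectangle] at hz
    simp only [Matrix.cons_val_zero, Matrix.cons_val_one, zero_add] at hz
    push_cast at hz
    exact ⟨hz.2.2.1, hz.2.2.2⟩
  -- the beam
  obtain ⟨x, hx, y, hy, hxy⟩ := hH
  rw [mem_image_add_leftSide] at hx
  rw [mem_image_add_rightSide] at hy
  simp only [Matrix.cons_val_zero, Matrix.cons_val_one, zero_add] at hx hy
  push_cast at hx hy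
  -- its part before the first visit to the column `4q`, inside the pillar box `[2q,4q] × [0,4q]`
  obtain ⟨z₁, hz₁0, hxz₁⟩ := exists_openConnIn_column hω (4 * (q : ℤ)) (by rw [hx.2]; omega)
    (by rw [hy.2]; omega) hxy
  obtain ⟨P₁, hP₁S, hP₁ω⟩ := exists_walk_of_mem_openConnIn hω hxz₁
  have hP₁box : ∀ w ∈ P₁.support,
      2 * (q : ℤ) ≤ w 0 ∧ w 0 ≤ 4 * (q : ℤ) ∧ 0 ≤ w 1 ∧ w 1 ≤ 4 * (q : ℤ) := by
    intro w hw
    have h := hP₁S w hw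
    rw [mem_inter_iff, mem_image_add_rectangle, mem_setOf_eq] at h
    simp only [Matrix.cons_val_zero, Matrix.cons_val_one, zero_add] at h
    push_cast at h
    omega
  -- the pillar
  obtain ⟨b, hb, t, ht, hbt⟩ := hV
  rw [mem_image_add_bottomSide] at hb
  rw [mem_image_add_topSide] at ht
  simp only [Matrix.cons_val_zero, Matrix.cons_val_one, zero_add] at hb ht
  push_cast at hb ht
  obtain ⟨Q₁, hQ₁S, hQ₁ω⟩ := exists_walk_of_mem_openConnIn hω hbt
  have hQ₁box : ∀ w ∈ Q₁.support,
      2 * (q : ℤ) ≤ w 0 ∧ w 0 ≤ 4 * (q : ℤ) ∧ 0 ≤ w 1 ∧ w 1 ≤ 4 * (q : ℤ) := by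
    intro w hw
    have h := hQ₁S w hw
    rw [mem_image_add_rectangle] at h
    simp only [Matrix.cons_val_zero, Matrix.cons_val_one, zero_add] at h
    push_cast at h
    omega
  -- they meet
  obtain ⟨w₁, hw₁P, hw₁Q⟩ := exists_mem_support_of_crossing (L := 2 * (q : ℤ)) (R := 4 * (q : ℤ))
    (B := 0) (T := 4 * (q : ℤ)) P₁ Q₁ hP₁box hQ₁box hx.2 hz₁0 hb.2 ht.2
  -- assemble `b ↔ w₁ ↔ x ↔ y` inside the strip
  have c₁ : ω ∈ openConnIn T b w₁ :=
    openConnIn_mono hVT _ _ (mem_openConnIn_of_mem_support Q₁ hQ₁S hQ₁ω hw₁Q)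
  have c₂ : ω ∈ openConnIn T w₁ x :=
    SymmDiff.conn_symm (openConnIn_mono (inter_subset_left.trans hHT) _ _
      (mem_openConnIn_of_mem_support P₁ hP₁S hP₁ω hw₁P))
  have c₃ : ω ∈ openConnIn T x y := openConnIn_mono hHT _ _ hxy
  have hbeq : bpt (b 0) = b := ((site_eq_bpt_iff b (b 0)).2 ⟨hb.2, rfl⟩).symm
  refine ⟨b 0, by omega, by omega, y, by omega, ?_⟩
  rw [hbeq]
  exact PlanarDuality.openConnIn_trans (PlanarDuality.openConnIn_trans c₁ c₂) c₃

/-- **Werner's counting, deterministic half** (in the tree's `TwoArm.liso` vocabulary): under the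
shield, pillar and beam hypotheses, the least `u ∈ [0,4q]` with `(u,0)` joined inside `ℤ × [0,4q]` to
the column `8q+1` carries `liso u (4q)`. [folklore] -/
theorem exists_liso {q : ℕ} {ω : BondConfig (Site 2)} (hω : ω ⊆ (zdGraph 2).edgeSet)
    (hD : ω ∉ lrCrossing q (4 * q))
    (hV : ω ∈ openCrossing
      ((· + (![2 * (q : ℤ), 0] : Site 2)) '' (↑(rectangle (2 * q) (4 * q)) : Set (Site 2)))
      ((· + (![2 * (q : ℤ), 0] : Site 2)) '' (↑(bottomSide (2 * q) (4 * q)) : Set (Site 2)))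
      ((· + (![2 * (q : ℤ), 0] : Site 2)) '' (↑(topSide (2 * q) (4 * q)) : Set (Site 2))))
    (hH : ω ∈ openCrossing
      ((· + (![2 * (q : ℤ), 0] : Site 2)) '' (↑(rectangle (6 * q + 1) (4 * q)) : Set (Site 2)))
      ((· + (![2 * (q : ℤ), 0] : Site 2)) '' (↑(leftSide (6 * q + 1) (4 * q)) : Set (Site 2)))
      ((· + (![2 * (q : ℤ), 0] : Site 2)) '' (↑(rightSide (6 * q + 1) (4 * q)) : Set (Site 2)))) :
    ∃ u : ℤ, 0 ≤ u ∧ u ≤ 4 * (q : ℤ) ∧ ω ∈ TwoArm.liso u (4 * q) := by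
  set T : Set (Site 2) := {z : Site 2 | 0 ≤ z 1 ∧ z 1 ≤ 4 * (q : ℤ)} with hT
  obtain ⟨b₀, hb₀0, hb₀4, hReach⟩ := exists_reach hω hV hH
  -- the leftmost point of `[0,4q] × {0}` joined inside `T` to the column `8q+1`
  obtain ⟨u, ⟨hu0, hu4, w, hw0, huw⟩, humin⟩ := Int.exists_least_of_bdd
    (P := fun u : ℤ ↦ 0 ≤ u ∧ u ≤ 4 * (q : ℤ) ∧
      ∃ y : Site 2, y 0 = 8 * (q : ℤ) + 1 ∧ ω ∈ openConnIn T (bpt u) y)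
    ⟨0, fun _ hz ↦ hz.1⟩ ⟨b₀, hb₀0, hb₀4, hReach⟩
  refine ⟨u, hu0, hu4, ?_, ?_⟩
  · -- ARM: the column `8q+1` lies outside `Λ⁺_{4q}(u)`
    have hTH : T ⊆ halfPlane := fun _ hz ↦ hz.1
    have hwbox : w ∉ SymmDiff.hbox u (4 * q) := by
      rintro ⟨-, -, -, h4⟩
      push_cast at h4
      omega
    exact SymmDiff.arm_of_far hω hwbox (openConnIn_mono hTH _ _ huw)
  · -- ISOLATION
    rintro ⟨v, ⟨hv1, hv0, hv0'⟩, y, hy, hvy⟩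
    obtain rfl : y = bpt u := hy
    push_cast at hv0
    have hboxT : TwoArm.hb u (4 * q) ⊆ T := by
      rintro z ⟨h1, h2, -, -⟩
      push_cast at h2
      exact ⟨h1, h2⟩
    have hvw : ω ∈ openConnIn T v w :=
      PlanarDuality.openConnIn_trans (openConnIn_mono hboxT _ _ hvy) huw
    rcases le_or_gt 0 (v 0) with h0 | h0
    · -- `v₀ ≥ 0` contradicts the minimality of `u`
      have hveq : bpt (v 0) = v := ((site_eq_bpt_iff v (v 0)).2 ⟨hv1, rfl⟩).symm
      have hle := humin (v 0) ⟨h0, by omega, w, hw0, by rw [hveq]; exact hvw⟩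
      omega
    · -- `v₀ < 0`: the path to the column `8q+1` crosses the shield box
      exact hD (lrCrossing_of_conn hω h0.le (by omega) hvw)

end LisoOfGlobal

/-- **STUB 2 of the skeleton `Sketch_TwoArmLower` (registered signature): the deterministic half
of Werner's counting argument, mirrored, primal form.**  For `q ≥ 1` and a lattice configuration:
no open left–right crossing of `[0,q] × [0,4q]`, an open top–bottom crossing of `[2q,4q] × [0,4q]`
and an open left–right crossing of `[2q,8q+1] × [0,4q]` force the left-isolated arm event
`liso u (4q)` at some `u ∈ [0,4q]`. [folklore] -/
theorem stub_lisoOfGlobal :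
    ∀ q : ℕ, 1 ≤ q → ∀ ω : BondConfig (Site 2), ω ⊆ (zdGraph 2).edgeSet →
      ω ∉ lrCrossing q (4 * q) →
      ω ∈ openCrossing
            ((· + (![2 * (q : ℤ), 0] : Site 2)) '' (↑(rectangle (2 * q) (4 * q)) : Set (Site 2)))
            ((· + (![2 * (q : ℤ), 0] : Site 2)) '' (↑(bottomSide (2 * q) (4 * q)) : Set (Site 2)))
            ((· + (![2 * (q : ℤ), 0] : Site 2)) '' (↑(topSide (2 * q) (4 * q)) : Set (Site 2))) →
      ω ∈ openCrossing
            ((· + (![2 * (q : ℤ), 0] : Site 2)) '' (↑(rectangle (6 * q + 1) (4 * q)) : Set (Site 2)))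
            ((· + (![2 * (q : ℤ), 0] : Site 2)) '' (↑(leftSide (6 * q + 1) (4 * q)) : Set (Site 2)))
            ((· + (![2 * (q : ℤ), 0] : Site 2)) '' (↑(rightSide (6 * q + 1) (4 * q)) : Set (Site 2))) →
      ∃ u : ℤ, 0 ≤ u ∧ u ≤ 4 * q ∧
        ω ∈ openCrossing
                {v : Site 2 | 0 ≤ v 1 ∧ v 1 ≤ ((4 * q : ℕ) : ℤ) ∧
                  u - (4 * q : ℕ) ≤ v 0 ∧ v 0 ≤ u + (4 * q : ℕ)}
                {bpt u}
                {v : Site 2 | v 0 = u - (4 * q : ℕ) ∨ v 0 = u + (4 * q : ℕ) ∨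
                  v 1 = ((4 * q : ℕ) : ℤ)} \
              openCrossing
                {v : Site 2 | 0 ≤ v 1 ∧ v 1 ≤ ((4 * q : ℕ) : ℤ) ∧
                  u - (4 * q : ℕ) ≤ v 0 ∧ v 0 ≤ u + (4 * q : ℕ)}
                (rowIcc (u - (4 * q : ℕ)) (u - 1)) {bpt u} := by
  intro q _ ω hω hD hV hH
  exact LisoOfGlobal.exists_liso hω hD hV hH

end TwoArmLower

end Summit.CriticalPhenomena.CardyFormulaZ2.Cruxes.HalfPlaneMarkDensityLaw.SketchLine

end
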